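import Literature.GroupTheory.CombinatorialGroupTheory.QuadraticWords
import Mathlib.Algebra.Group.MinimalAxioms
import Mathlib.Algebra.BigOperators.Fin
import HarnessLib

/-!
# The intersection form of a quadratic word

Topic `Literature/GroupTheory/CombinatorialGroupTheory`.  For a word `w` over symbols `ι` and two
weights `ξ η : ι → ℤ`, the **form** `omega ξ η (mk w)` is the central coordinate of the evaluation
of `w` in the integer Heisenberg group `Heis` with `xᵢ ↦ (ξ i, η i, 0)`.  For an alternating
quadratic word this is the algebraic intersection number of the two classes `ξ, η` on the
surface with boundary word `w` (ZVC §3.6, 3.6.1–3.6.3); we only need its formal properties: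

* `hom_mk_abc` — the evaluation of a word under ANY homomorphism `F(ι) → Heis` in terms of the
  generator data: linear parts are signed sums (`lsum`), and the central part is the
  combinatorial form `omegaW` plus a signed sum; hence (`omega_map_mk_of_balanced`) for a
  **balanced** word (every symbol with exponent sum `0`) the form is natural under endomorphisms
  of the free group through the pull-back of weights `pull`, and invariant under conjugation;
* `omega_single_interlink` — with `ξ` the indicator of a symbol `p` of a quadratic word
  `W₁ p T p̄ W₂`, the form against `η` is `± (signed η-sum over T)`: **`ω(p, ·)` counts the
  symbols interlinked with `p`** (ZVC 3.6.1–3.6.3 read on the boundary word);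
* `Nondeg w` — nondegeneracy of the form; it transports along automorphisms carrying one
  balanced word to a conjugate of another (`Nondeg.transport`), detects a symbol interlinked with
  any given one (`Nondeg.exists_interlinked`), and holds for the standard surface word
  `∏ [aᵢ, bᵢ]` (`nondeg_surfaceWordStd`), whose form is the standard symplectic form
  (`omega_surfaceWordStd`).

These are the ingredients of the endgame of the classification of epimorphisms of surface groups
onto free groups (`QuadraticWordsGathering`), replacing the topological "pairs of interlinked
curves" of the proof of ZVC 3.2.4 and of Thm. 5.2.8.

## References

* H. Zieschang, E. Vogt, H.-D. Coldewey, *Surfaces and Planar Discontinuous Groups*, LNM 835,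
  Springer 1980, §3.2 (3.2.2–3.2.6, normal forms by bifurcations), §3.6 (3.6.1–3.6.3,
  intersection numbers), §5.2 (Thm. 5.2.8 and its proof), E 5.4.
* R. C. Lyndon, P. E. Schupp, *Combinatorial Group Theory*, Springer 1977, I §7 (quadratic words).
-/

namespace Literature.GroupTheory.CombinatorialGroupTheory

open List

/-! ### The integer Heisenberg group -/

/-- The integer Heisenberg group in coordinates `(a, b, c)` with multiplication
`(a,b,c)·(a',b',c') = (a+a', b+b', c+c'+ab')` (upper unitriangular `3 × 3` integer matrices).
[folklore] -/
@[ext] structure Heis : Type where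
  /-- entry `(0,1)` -/
  a : ℤ
  /-- entry `(1,2)` -/
  b : ℤ
  /-- entry `(0,2)` -/
  c : ℤ

namespace Heis

/-- Multiplication `(a,b,c)·(a',b',c') = (a+a', b+b', c+c'+ab')`. [folklore] -/
instance : Mul Heis := ⟨fun x y => ⟨x.a + y.a, x.b + y.b, x.c + y.c + x.a * y.b⟩⟩
/-- The identity `(0,0,0)`. [folklore] -/
instance : One Heis := ⟨⟨0, 0, 0⟩⟩
/-- The inverse `(a,b,c)⁻¹ = (-a, -b, -c+ab)`. [folklore] -/
instance : Inv Heis := ⟨fun x => ⟨-x.a, -x.b, -x.c + x.a * x.b⟩⟩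

/-- First coordinate of a product. [folklore] -/
@[simp] theorem mul_a (x y : Heis) : (x * y).a = x.a + y.a := rfl
/-- Second coordinate of a product. [folklore] -/
@[simp] theorem mul_b (x y : Heis) : (x * y).b = x.b + y.b := rfl
/-- Central coordinate of a product. [folklore] -/
@[simp] theorem mul_c (x y : Heis) : (x * y).c = x.c + y.c + x.a * y.b := rfl
/-- First coordinate of the identity. [folklore] -/
@[simp] theorem one_a : (1 : Heis).a = 0 := rfl
/-- Second coordinate of the identity. [folklore] -/
@[simp] theorem one_b : (1 : Heis).b = 0 := rfl
/-- Central coordinate of the identity. [folklore] -/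
@[simp] theorem one_c : (1 : Heis).c = 0 := rfl
/-- First coordinate of an inverse. [folklore] -/
@[simp] theorem inv_a (x : Heis) : x⁻¹.a = -x.a := rfl
/-- Second coordinate of an inverse. [folklore] -/
@[simp] theorem inv_b (x : Heis) : x⁻¹.b = -x.b := rfl
/-- Central coordinate of an inverse. [folklore] -/
@[simp] theorem inv_c (x : Heis) : x⁻¹.c = -x.c + x.a * x.b := rfl

/-- The Heisenberg group is a group. [folklore] -/
instance : Group Heis :=
  Group.ofLeftAxioms
    (fun x y z => Heis.ext (by simp only [mul_a]; ring) (by simp only [mul_b]; ring)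
      (by simp only [mul_c, mul_a, mul_b]; ring))
    (fun x => Heis.ext (by simp only [mul_a, one_a]; ring) (by simp only [mul_b, one_b]; ring)
      (by simp only [mul_c, one_c, one_a]; ring))
    (fun x => Heis.ext (by simp only [mul_a, inv_a, one_a]; ring)
      (by simp only [mul_b, inv_b, one_b]; ring)
      (by simp only [mul_c, inv_c, inv_a, one_c]; ring))

/-- Conjugating a central element does nothing to its central coordinate. [folklore] -/
theorem conj_c (p q : Heis) (ha : q.a = 0) (hb : q.b = 0) : (p * q * p⁻¹).c = q.c := by
  simp only [mul_c, mul_a, inv_b, inv_c, ha, hb]; ring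

/-- The commutator in the Heisenberg group is central … [folklore] -/
theorem comm_a (u v : Heis) : (u * v * u⁻¹ * v⁻¹).a = 0 := by simp only [mul_a, inv_a]; ring

/-- … (second coordinate) … [folklore] -/
theorem comm_b (u v : Heis) : (u * v * u⁻¹ * v⁻¹).b = 0 := by simp only [mul_b, inv_b]; ring

/-- … with central coordinate the symplectic pairing `a b' - a' b`. [folklore] -/
theorem comm_c (u v : Heis) : (u * v * u⁻¹ * v⁻¹).c = u.a * v.b - v.a * u.b := by
  simp only [mul_c, mul_a, inv_a, inv_b, inv_c]; ring

end Heis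

variable {ι : Type*} [DecidableEq ι]

/-! ### Signed sums along a word -/

/-- The signed sum `∑ ±ξ` over the letters of a word: the additive character of `F(ι)` with
values `ξ` on the generators, computed on a word. [folklore] -/
def lsum (ξ : ι → ℤ) (L : List (ι × Bool)) : ℤ := (L.map fun x => bif x.2 then ξ x.1 else -ξ x.1).sum

omit [DecidableEq ι] in
/-- Signed sum of the empty word. [folklore] -/
@[simp] theorem lsum_nil (ξ : ι → ℤ) : lsum ξ ([] : List (ι × Bool)) = 0 := rfl

omit [DecidableEq ι] in
/-- Signed sum of a word with a letter prefixed. [folklore] -/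
@[simp] theorem lsum_cons (ξ : ι → ℤ) (x : ι × Bool) (L : List (ι × Bool)) :
    lsum ξ (x :: L) = (bif x.2 then ξ x.1 else -ξ x.1) + lsum ξ L := by
  simp [lsum]

omit [DecidableEq ι] in
/-- Signed sums are additive under concatenation. [folklore] -/
@[simp] theorem lsum_append (ξ : ι → ℤ) (L M : List (ι × Bool)) :
    lsum ξ (L ++ M) = lsum ξ L + lsum ξ M := by
  simp [lsum, sum_append]

omit [DecidableEq ι] in
/-- A signed sum of zero weights vanishes. [folklore] -/
theorem lsum_eq_zero_of_forall {ξ : ι → ℤ} {L : List (ι × Bool)} (h : ∀ x ∈ L, ξ x.1 = 0) :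
    lsum ξ L = 0 := by
  induction L with
  | nil => rfl
  | cons x L ih =>
    rw [lsum_cons, ih fun y hy => h y (mem_cons_of_mem _ hy), h x mem_cons_self]
    cases x.2 <;> simp

/-- The signed sum in terms of letter counts. [folklore] -/
theorem lsum_eq_sum_count [Fintype ι] (ξ : ι → ℤ) (L : List (ι × Bool)) :
    lsum ξ L = ∑ i, ξ i * ((L.count (i, true) : ℤ) - L.count (i, false)) := by
  induction L with
  | nil => simp
  | cons x L ih =>
    obtain ⟨j, b⟩ := x
    have key : ∀ i, ((count (i, true) ((j, b) :: L) : ℤ) - count (i, false) ((j, b) :: L))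
        = ((count (i, true) L : ℤ) - count (i, false) L) + (if i = j then (bif b then 1 else -1) else 0) := by
      intro i
      simp only [count_cons]
      by_cases hij : i = j
      · subst hij
        cases b <;> simp <;> ring
      · have h1 : ((j, b) == (i, true)) = false := by simp [Ne.symm hij]
        have h2 : ((j, b) == (i, false)) = false := by simp [Ne.symm hij]
        simp [h1, h2, hij]
    simp_rw [key, mul_add, Finset.sum_add_distrib, ← ih, mul_ite, mul_zero, Finset.sum_ite_eq',
      Finset.mem_univ, if_true, lsum_cons]
    cases b <;> simp [add_comm]

/-- A nonzero signed sum has an unbalanced symbol of nonzero weight. [folklore] -/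
theorem exists_of_lsum_ne_zero [Fintype ι] {ξ : ι → ℤ} {L : List (ι × Bool)} (h : lsum ξ L ≠ 0) :
    ∃ i, ξ i ≠ 0 ∧ L.count (i, true) ≠ L.count (i, false) := by
  rw [lsum_eq_sum_count] at h
  obtain ⟨i, -, hi⟩ := Finset.exists_ne_zero_of_sum_ne_zero h
  refine ⟨i, left_ne_zero_of_mul hi, fun he => ?_⟩
  rw [he, sub_self, mul_zero] at hi
  exact hi rfl

/-! ### Balanced words -/

/-- A word is **balanced** if every symbol has exponent sum zero. [folklore] -/
def IsBalanced (L : List (ι × Bool)) : Prop := ∀ i, L.count (i, true) = L.count (i, false)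

/-- Quadratic words are balanced. [folklore] -/
theorem IsQuadratic.isBalanced {w : List (ι × Bool)} (h : IsQuadratic w) : IsBalanced w :=
  fun i => (h i).1

/-- A trivial word is balanced. [folklore] -/
theorem isBalanced_of_mk_eq_one {L : List (ι × Bool)} (h : FreeGroup.mk L = 1) : IsBalanced L :=
  count_true_eq_count_false_of_mk_eq_one h

/-- Signed sums vanish on balanced words. [folklore] -/
theorem IsBalanced.lsum_eq_zero [Fintype ι] {L : List (ι × Bool)} (h : IsBalanced L) (ξ : ι → ℤ) :
    lsum ξ L = 0 := by
  rw [lsum_eq_sum_count]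
  exact Finset.sum_eq_zero fun i _ => by rw [h i, sub_self, mul_zero]

/-! ### Evaluation in the Heisenberg group -/

/-- The combinatorial form of a word with weights `α, β` (the central coordinate of its
Heisenberg evaluation, see `heisHom_mk_c`). [folklore] -/
def omegaW (α β : ι → ℤ) : List (ι × Bool) → ℤ
  | [] => 0
  | (i, true) :: L => α i * lsum β L + omegaW α β L
  | (i, false) :: L => α i * β i - α i * lsum β L + omegaW α β L

omit [DecidableEq ι] in
/-- The form vanishes if the first weight vanishes along the word. [folklore] -/
theorem omegaW_eq_zero_of_forall {α β : ι → ℤ} {L : List (ι × Bool)} (h : ∀ x ∈ L, α x.1 = 0) :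
    omegaW α β L = 0 := by
  induction L with
  | nil => rfl
  | cons x L ih =>
    have hx := h x mem_cons_self
    have ih' := ih fun y hy => h y (mem_cons_of_mem _ hy)
    obtain ⟨i, _ | _⟩ := x
    · simp only [omegaW, ih']; simp only at hx; rw [hx]; ring
    · simp only [omegaW, ih']; simp only at hx; rw [hx]; ring

omit [DecidableEq ι] in
/-- **Evaluation of a word under a homomorphism to the Heisenberg group** in terms of the
generator images: the linear coordinates are signed sums, the central coordinate is the form of
the linear data plus the signed sum of the central data. [folklore] -/
theorem hom_mk_abc (h : FreeGroup ι →* Heis) (L : List (ι × Bool)) :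
    (h (FreeGroup.mk L)).a = lsum (fun i => (h (FreeGroup.of i)).a) L ∧
    (h (FreeGroup.mk L)).b = lsum (fun i => (h (FreeGroup.of i)).b) L ∧
    (h (FreeGroup.mk L)).c =
      omegaW (fun i => (h (FreeGroup.of i)).a) (fun i => (h (FreeGroup.of i)).b) L
        + lsum (fun i => (h (FreeGroup.of i)).c) L := by
  induction L with
  | nil => simp [show (FreeGroup.mk [] : FreeGroup ι) = 1 from rfl, omegaW]
  | cons x L ih =>
    obtain ⟨ha, hb, hc⟩ := ih
    obtain ⟨i, _ | _⟩ := x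
    · rw [mk_cons_eq_sgen_mul, map_mul, sgen_false, map_inv]
      refine ⟨?_, ?_, ?_⟩
      · simp only [Heis.mul_a, Heis.inv_a, ha, lsum_cons, cond_false]
      · simp only [Heis.mul_b, Heis.inv_b, hb, lsum_cons, cond_false]
      · simp only [Heis.mul_c, Heis.inv_c, Heis.inv_a, hb, hc, lsum_cons, cond_false, omegaW]
        ring
    · rw [mk_cons_eq_sgen_mul, map_mul, sgen_true]
      refine ⟨?_, ?_, ?_⟩
      · simp only [Heis.mul_a, ha, lsum_cons, cond_true]
      · simp only [Heis.mul_b, hb, lsum_cons, cond_true]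
      · simp only [Heis.mul_c, hb, hc, lsum_cons, cond_true, omegaW]
        ring

/-- The Heisenberg evaluation `xᵢ ↦ (ξ i, η i, 0)`. [folklore] -/
def heisHom (ξ η : ι → ℤ) : FreeGroup ι →* Heis := FreeGroup.lift fun i => ⟨ξ i, η i, 0⟩

omit [DecidableEq ι] in
/-- The Heisenberg evaluation of a generator. [folklore] -/
@[simp] theorem heisHom_of (ξ η : ι → ℤ) (i : ι) : heisHom ξ η (FreeGroup.of i) = ⟨ξ i, η i, 0⟩ :=
  FreeGroup.lift_apply_of

omit [DecidableEq ι] in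
/-- The Heisenberg evaluation of a signed generator. [folklore] -/
theorem heisHom_sgen (ξ η : ι → ℤ) (i : ι) (s : Bool) :
    heisHom ξ η (sgen i s) = bif s then ⟨ξ i, η i, 0⟩ else ⟨-ξ i, -η i, ξ i * η i⟩ := by
  cases s
  · rw [sgen_false, map_inv, heisHom_of]
    exact Heis.ext rfl rfl (by simp)
  · rw [sgen_true, heisHom_of]; rfl

/-- **The form** of `x ∈ F(ι)` with weights `ξ, η`: the central coordinate of its Heisenberg
evaluation. [cite: ZieschangVogtColdewey1980, 3.6.1–3.6.3] -/
def omega (ξ η : ι → ℤ) (x : FreeGroup ι) : ℤ := (heisHom ξ η x).c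

omit [DecidableEq ι] in
/-- First coordinate of the Heisenberg evaluation of a word. [folklore] -/
theorem heisHom_mk_a (ξ η : ι → ℤ) (L : List (ι × Bool)) : (heisHom ξ η (FreeGroup.mk L)).a = lsum ξ L := by
  rw [(hom_mk_abc (heisHom ξ η) L).1]; simp

omit [DecidableEq ι] in
/-- Second coordinate of the Heisenberg evaluation of a word. [folklore] -/
theorem heisHom_mk_b (ξ η : ι → ℤ) (L : List (ι × Bool)) : (heisHom ξ η (FreeGroup.mk L)).b = lsum η L := by
  rw [(hom_mk_abc (heisHom ξ η) L).2.1]; simp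

omit [DecidableEq ι] in
/-- The form of a word is the combinatorial form. [folklore] -/
theorem omega_mk (ξ η : ι → ℤ) (L : List (ι × Bool)) : omega ξ η (FreeGroup.mk L) = omegaW ξ η L := by
  rw [omega, (hom_mk_abc (heisHom ξ η) L).2.2]
  simp [lsum_eq_zero_of_forall]

omit [DecidableEq ι] in
/-- The Heisenberg evaluation of a word along which the first weight vanishes. [folklore] -/
theorem heisHom_mk_of_vanish {ξ : ι → ℤ} (η : ι → ℤ) {L : List (ι × Bool)} (h : ∀ x ∈ L, ξ x.1 = 0) :
    heisHom ξ η (FreeGroup.mk L) = ⟨0, lsum η L, 0⟩ :=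
  Heis.ext (by rw [heisHom_mk_a, lsum_eq_zero_of_forall h]) (heisHom_mk_b ξ η L)
    (by rw [← omega, omega_mk, omegaW_eq_zero_of_forall h])

/-! ### Naturality -/

/-- **Pull-back of weights** along an endomorphism `ψ` of the free group:
`(pull ψ ξ) i = ξ̂(ψ xᵢ)`, the weight `ξ` summed along `ψ xᵢ`. [folklore] -/
def pull (ψ : FreeGroup ι →* FreeGroup ι) (ξ : ι → ℤ) : ι → ℤ := fun i => lsum ξ (ψ (FreeGroup.of i)).toWord

/-- The additive character with generator values `ξ`. [folklore] -/
def achar (ξ : ι → ℤ) : FreeGroup ι →* Multiplicative ℤ :=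
  FreeGroup.lift fun i => Multiplicative.ofAdd (ξ i)

omit [DecidableEq ι] in
/-- The additive character of a word is its signed sum. [folklore] -/
theorem achar_mk (ξ : ι → ℤ) (L : List (ι × Bool)) :
    achar ξ (FreeGroup.mk L) = Multiplicative.ofAdd (lsum ξ L) := by
  induction L with
  | nil => simp [show (FreeGroup.mk [] : FreeGroup ι) = 1 from rfl]
  | cons x L ih =>
    rw [mk_cons_eq_sgen_mul, map_mul, ih, lsum_cons, ofAdd_add]
    congr 1
    obtain ⟨i, _ | _⟩ := x
    · rw [sgen_false, map_inv, achar, FreeGroup.lift_apply_of, ← ofAdd_neg]; rfl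
    · rw [sgen_true, achar, FreeGroup.lift_apply_of]; rfl

/-- The signed sum along the reduced word of an element is its character value. [folklore] -/
theorem lsum_toWord (ξ : ι → ℤ) (x : FreeGroup ι) : lsum ξ x.toWord = (achar ξ x).toAdd := by
  conv_rhs => rw [← FreeGroup.mk_toWord (x := x)]
  rw [achar_mk, toAdd_ofAdd]

/-- The character of pulled-back weights is the pulled-back character. [folklore] -/
theorem achar_pull (ψ : FreeGroup ι →* FreeGroup ι) (ξ : ι → ℤ) : achar (pull ψ ξ) = (achar ξ).comp ψ := by
  ext i
  simp only [achar, FreeGroup.lift_apply_of, MonoidHom.coe_comp, Function.comp_apply, pull]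
  rw [lsum_toWord, ofAdd_toAdd]; rfl

/-- `pull` is contravariantly functorial. [folklore] -/
theorem pull_comp (ψ φ : FreeGroup ι →* FreeGroup ι) (ξ : ι → ℤ) :
    pull (ψ.comp φ) ξ = pull φ (pull ψ ξ) := by
  funext i
  simp only [pull, MonoidHom.coe_comp, Function.comp_apply]
  rw [lsum_toWord, lsum_toWord, achar_pull]; rfl

/-- `pull` along the identity. [folklore] -/
theorem pull_id (ξ : ι → ℤ) : pull (MonoidHom.id _) ξ = ξ := by
  funext i; simp [pull, FreeGroup.toWord_of]

/-- Pulling back the zero weight gives zero. [folklore] -/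
theorem pull_zero (ψ : FreeGroup ι →* FreeGroup ι) : pull ψ (0 : ι → ℤ) = 0 := by
  funext i; exact lsum_eq_zero_of_forall fun _ _ => rfl

/-- `pull` along an automorphism is undone by `pull` along its inverse. [folklore] -/
theorem pull_mulAut_inv (ψ : MulAut (FreeGroup ι)) (ξ : ι → ℤ) :
    pull ψ.toMonoidHom (pull ψ⁻¹.toMonoidHom ξ) = ξ := by
  rw [← pull_comp]
  have : (ψ⁻¹.toMonoidHom.comp ψ.toMonoidHom : FreeGroup ι →* FreeGroup ι) = MonoidHom.id _ :=
    MonoidHom.ext fun x => by simp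
  rw [this, pull_id]

/-- `pull` along the inverse of an automorphism is undone by `pull` along it. [folklore] -/
theorem pull_mulAut_inv' (ψ : MulAut (FreeGroup ι)) (ξ : ι → ℤ) :
    pull ψ⁻¹.toMonoidHom (pull ψ.toMonoidHom ξ) = ξ := by
  simpa using pull_mulAut_inv ψ⁻¹ ξ

/-- The linear coordinates of `x ↦ heisHom ξ η (ψ x)` on a word. [folklore] -/
theorem heisHom_map_mk_ab (ξ η : ι → ℤ) (ψ : FreeGroup ι →* FreeGroup ι) (L : List (ι × Bool)) :
    (heisHom ξ η (ψ (FreeGroup.mk L))).a = lsum (pull ψ ξ) L ∧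
      (heisHom ξ η (ψ (FreeGroup.mk L))).b = lsum (pull ψ η) L := by
  have h := hom_mk_abc ((heisHom ξ η).comp ψ) L
  simp only [MonoidHom.coe_comp, Function.comp_apply] at h
  refine ⟨h.1.trans ?_, h.2.1.trans ?_⟩
  · congr 1; funext i
    conv_lhs => rw [← FreeGroup.mk_toWord (x := ψ (FreeGroup.of i))]
    rw [heisHom_mk_a]; rfl
  · congr 1; funext i
    conv_lhs => rw [← FreeGroup.mk_toWord (x := ψ (FreeGroup.of i))]
    rw [heisHom_mk_b]; rfl

/-- **Naturality of the form on balanced words**: for an endomorphism `ψ` of the free group and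
a balanced word `L`, `ω_{ξ,η}(ψ L) = ω_{ψ^*ξ, ψ^*η}(L)`. [folklore] -/
theorem omega_map_mk_of_balanced [Fintype ι] (ξ η : ι → ℤ) (ψ : FreeGroup ι →* FreeGroup ι)
    {L : List (ι × Bool)} (hL : IsBalanced L) :
    omega ξ η (ψ (FreeGroup.mk L)) = omega (pull ψ ξ) (pull ψ η) (FreeGroup.mk L) := by
  have h := hom_mk_abc ((heisHom ξ η).comp ψ) L
  simp only [MonoidHom.coe_comp, Function.comp_apply] at h
  rw [omega, h.2.2, hL.lsum_eq_zero, add_zero, omega_mk]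
  congr 1
  · funext i
    conv_lhs => rw [← FreeGroup.mk_toWord (x := ψ (FreeGroup.of i))]
    rw [heisHom_mk_a]; rfl
  · funext i
    conv_lhs => rw [← FreeGroup.mk_toWord (x := ψ (FreeGroup.of i))]
    rw [heisHom_mk_b]; rfl

/-- **Conjugation invariance of the form on balanced words.** [folklore] -/
theorem omega_conj_map_mk_of_balanced [Fintype ι] (ξ η : ι → ℤ) (ψ : FreeGroup ι →* FreeGroup ι)
    (c : FreeGroup ι) {L : List (ι × Bool)} (hL : IsBalanced L) :
    omega ξ η (c * ψ (FreeGroup.mk L) * c⁻¹) = omega ξ η (ψ (FreeGroup.mk L)) := by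
  have hab := heisHom_map_mk_ab ξ η ψ L
  rw [hL.lsum_eq_zero, hL.lsum_eq_zero] at hab
  rw [omega, map_mul, map_mul, map_inv, Heis.conj_c _ _ hab.1 hab.2, omega]

/-! ### Interlinking -/

omit [DecidableEq ι] in
/-- The indicator weight of `p` vanishes along a word avoiding `p`. [folklore] -/
private theorem vanish_single_of_avoids [DecidableEq ι] {p : ι} {L : List (ι × Bool)} (h : Avoids p L) :
    ∀ x ∈ L, (Pi.single p (1 : ℤ) : ι → ℤ) x.1 = 0 :=
  fun x hx => Pi.single_eq_of_ne (h x hx) _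

/-- **The form against the indicator of a symbol counts interlinking** (ZVC 3.6.1–3.6.3): for a word
`W₁ p^{(s)} T p^{(!s)} W₂` in which `p` occurs nowhere else,
`ω(𝟙_p, η) = ± (signed η-sum over T)`. [cite: ZieschangVogtColdewey1980, 3.6.1–3.6.3] -/
theorem omega_single_interlink (p : ι) (s : Bool) (η : ι → ℤ) (W₁ T W₂ : List (ι × Bool))
    (h₁ : Avoids p W₁) (hT : Avoids p T) (h₂ : Avoids p W₂) :
    omega (Pi.single p 1) η (FreeGroup.mk (W₁ ++ (p, s) :: (T ++ (p, !s) :: W₂))) =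
      (bif s then 1 else -1) * lsum η T := by
  rw [omega, mk_append, mk_cons_eq_sgen_mul, mk_append, mk_cons_eq_sgen_mul]
  simp only [map_mul, heisHom_mk_of_vanish η (vanish_single_of_avoids h₁),
    heisHom_mk_of_vanish η (vanish_single_of_avoids hT),
    heisHom_mk_of_vanish η (vanish_single_of_avoids h₂), heisHom_sgen, Pi.single_eq_same]
  cases s <;> simp <;> ring

/-! ### Nondegeneracy -/

/-- **Nondegeneracy of the form of a word**: every nonzero weight pairs nontrivially with some
weight. [folklore] -/
def Nondeg (w : List (ι × Bool)) : Prop :=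
  ∀ ξ : ι → ℤ, ξ ≠ 0 → ∃ η : ι → ℤ, omega ξ η (FreeGroup.mk w) ≠ 0

/-- **Transport of nondegeneracy**: if an automorphism carries `w'` to a conjugate of the
balanced word `w`, nondegeneracy passes from `w` to `w'`. [folklore] -/
theorem Nondeg.transport [Fintype ι] {w w' : List (ι × Bool)} (hN : Nondeg w) (hb : IsBalanced w)
    (ψ : MulAut (FreeGroup ι)) (c : FreeGroup ι)
    (h : ψ (FreeGroup.mk w') = c * FreeGroup.mk w * c⁻¹) : Nondeg w' := by
  intro ξ hξ
  have e : FreeGroup.mk w' = ψ⁻¹ c * ψ⁻¹.toMonoidHom (FreeGroup.mk w) * (ψ⁻¹ c)⁻¹ := by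
    rw [← map_inv, MulEquiv.coe_toMonoidHom, ← map_mul, ← map_mul, ← h, MulAut.inv_apply_self]
  set ξ₀ := pull ψ⁻¹.toMonoidHom ξ with hξ₀
  have hξ₀0 : ξ₀ ≠ 0 := fun h0 => hξ (by
    rw [← pull_mulAut_inv ψ ξ, ← hξ₀, h0, pull_zero])
  obtain ⟨η₀, hη₀⟩ := hN ξ₀ hξ₀0
  refine ⟨pull ψ.toMonoidHom η₀, ?_⟩
  rwa [e, omega_conj_map_mk_of_balanced _ _ _ _ hb, omega_map_mk_of_balanced _ _ _ hb,
    pull_mulAut_inv']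

/-- **A nondegenerate quadratic word interlinks every symbol**: if `p` occurs in the quadratic
word `w = W₁ p^{(s)} T p^{(!s)} W₂` with nondegenerate form, some symbol `z` occurs exactly once
in `T`. [cite: ZieschangVogtColdewey1980, 3.2.4 (proof)] -/
theorem Nondeg.exists_interlinked [Fintype ι] {w W₁ T W₂ : List (ι × Bool)} {p : ι} {s : Bool}
    (hN : Nondeg w) (hq : IsQuadratic w) (hw : w = W₁ ++ (p, s) :: (T ++ (p, !s) :: W₂)) :
    ∃ (z : ι) (σ : Bool), (z, σ) ∈ T ∧ (z, !σ) ∉ T := by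
  subst hw
  obtain ⟨hA, hT, hC⟩ := hq.avoids_of_split
  have hξ : (Pi.single p (1 : ℤ) : ι → ℤ) ≠ 0 := fun h0 => by
    have := congrFun h0 p
    simp at this
  obtain ⟨η, hη⟩ := hN _ hξ
  rw [omega_single_interlink p s η W₁ T W₂ hA hT hC] at hη
  have hη' : lsum η T ≠ 0 := fun h0 => hη (by rw [h0, mul_zero])
  obtain ⟨z, -, hz⟩ := exists_of_lsum_ne_zero hη'
  have hsub : T <+ W₁ ++ (p, s) :: (T ++ (p, !s) :: W₂) :=
    ((sublist_append_left T _).trans (sublist_cons_self _ _)).trans (sublist_append_right _ _)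
  have h1 : T.count (z, true) ≤ 1 := (hsub.count_le _).trans (hq.count_le_one _)
  have h2 : T.count (z, false) ≤ 1 := (hsub.count_le _).trans (hq.count_le_one _)
  by_cases ht : T.count (z, true) = 1
  · refine ⟨z, true, count_pos_iff.1 (by omega), ?_⟩
    rw [Bool.not_true, ← count_eq_zero]; omega
  · refine ⟨z, false, count_pos_iff.1 (by omega), ?_⟩
    rw [Bool.not_false, ← count_eq_zero]; omega

/-! ### The standard surface word -/

omit [DecidableEq ι] in
/-- The form of a commutator block `[x_q, x_z]` prefixed to a word. [folklore] -/
theorem omega_mk_block_append (ξ η : ι → ℤ) (q z : ι) (L : List (ι × Bool)) :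
    omega ξ η (FreeGroup.mk ((q, true) :: (z, true) :: (q, false) :: (z, false) :: L)) =
      ξ q * η z - ξ z * η q + omega ξ η (FreeGroup.mk L) := by
  have e : FreeGroup.mk ((q, true) :: (z, true) :: (q, false) :: (z, false) :: L) =
      FreeGroup.of q * FreeGroup.of z * (FreeGroup.of q)⁻¹ * (FreeGroup.of z)⁻¹ * FreeGroup.mk L := by
    simp only [mk_cons_eq_sgen_mul, sgen_true, sgen_false, mul_assoc]
  rw [omega, omega, e, map_mul, Heis.mul_c]
  simp only [map_mul, map_inv, Heis.comm_a, Heis.comm_c, heisHom_of, zero_mul, add_zero]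

/-- The standard surface word `∏ᵢ [aᵢ, bᵢ]` over the symbols `Fin g × Bool`
(`aᵢ = (i, false)`, `bᵢ = (i, true)`). [folklore] -/
def surfaceWordStd (g : ℕ) : List ((Fin g × Bool) × Bool) :=
  (List.finRange g).flatMap fun i => [((i, false), true), ((i, true), true), ((i, false), false), ((i, true), false)]

/-- The form of a product of standard commutator blocks. [folklore] -/
private theorem omega_flatMap_blocks {g : ℕ} (ξ η : Fin g × Bool → ℤ) (l : List (Fin g)) :
    omega ξ η (FreeGroup.mk (l.flatMap fun i =>
      [((i, false), true), ((i, true), true), ((i, false), false), ((i, true), false)])) =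
      (l.map fun i => ξ (i, false) * η (i, true) - ξ (i, true) * η (i, false)).sum := by
  induction l with
  | nil =>
    rw [flatMap_nil, map_nil, sum_nil, show (FreeGroup.mk [] : FreeGroup (Fin g × Bool)) = 1 from rfl,
      omega, map_one, Heis.one_c]
  | cons i l ih =>
    rw [flatMap_cons, cons_append, cons_append, cons_append, cons_append, nil_append,
      omega_mk_block_append, ih, map_cons, sum_cons]

/-- **The form of the standard surface word is the standard symplectic form.**
[cite: ZieschangVogtColdewey1980, 3.6.3 (b)] -/
theorem omega_surfaceWordStd {g : ℕ} (ξ η : Fin g × Bool → ℤ) :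
    omega ξ η (FreeGroup.mk (surfaceWordStd g)) =
      ∑ i : Fin g, (ξ (i, false) * η (i, true) - ξ (i, true) * η (i, false)) := by
  rw [surfaceWordStd, omega_flatMap_blocks, Fin.sum_univ_def]

/-- **The form of the standard surface word is nondegenerate.** [folklore] -/
theorem nondeg_surfaceWordStd (g : ℕ) : Nondeg (surfaceWordStd g) := by
  intro ξ hξ
  obtain ⟨⟨i, t⟩, hi⟩ : ∃ x, ξ x ≠ 0 := Function.ne_iff.1 hξ
  refine ⟨Pi.single (i, !t) 1, ?_⟩
  rw [omega_surfaceWordStd, Finset.sum_eq_single i]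
  · cases t <;> simpa
  · intro j _ hj
    simp [Pi.single_eq_of_ne, hj]
  · simp

/-- A duplicate-free word containing the formal inverse of each of its letters is quadratic.
[folklore] -/
theorem IsQuadratic.of_nodup {w : List (ι × Bool)} (hd : w.Nodup) (hp : ∀ x ∈ w, (x.1, !x.2) ∈ w) :
    IsQuadratic w := by
  intro i
  refine ⟨?_, nodup_iff_count_le_one.1 hd _⟩
  by_cases ht : (i, true) ∈ w
  · have hf : (i, false) ∈ w := hp (i, true) ht
    rw [List.count_eq_one_of_mem hd ht, List.count_eq_one_of_mem hd hf]
  · have hf : (i, false) ∉ w := fun hf => ht (hp _ hf)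
    rw [count_eq_zero_of_not_mem ht, count_eq_zero_of_not_mem hf]

/-- Every letter occurs in the standard surface word. [folklore] -/
theorem mem_surfaceWordStd {g : ℕ} (x : (Fin g × Bool) × Bool) : x ∈ surfaceWordStd g := by
  obtain ⟨⟨i, t⟩, s⟩ := x
  rw [surfaceWordStd, mem_flatMap]
  exact ⟨i, mem_finRange i, by cases t <;> cases s <;> simp⟩

/-- The standard surface word has no repeated letter. [folklore] -/
theorem nodup_surfaceWordStd (g : ℕ) : (surfaceWordStd g).Nodup := by
  rw [surfaceWordStd, nodup_flatMap]
  have key : ∀ (c : Fin g) (x : (Fin g × Bool) × Bool),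
      x ∈ [((c, false), true), ((c, true), true), ((c, false), false), ((c, true), false)] → x.1.1 = c := by
    intro c x hx
    simp only [mem_cons, not_mem_nil, or_false] at hx
    rcases hx with rfl | rfl | rfl | rfl <;> rfl
  refine ⟨fun i _ => by simp, (nodup_finRange g).imp fun {a b} hab _ h1 h2 => ?_⟩
  exact hab ((key a _ h1).symm.trans (key b _ h2))

/-- The standard surface word is an alternating quadratic word. [folklore] -/
theorem isQuadratic_surfaceWordStd (g : ℕ) : IsQuadratic (surfaceWordStd g) :=
  IsQuadratic.of_nodup (nodup_surfaceWordStd g) fun x _ => mem_surfaceWordStd (x.1, !x.2)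

/-- The length of the standard surface word. [folklore] -/
theorem length_surfaceWordStd (g : ℕ) : (surfaceWordStd g).length = 4 * g := by
  simp [surfaceWordStd, length_flatMap, map_const', List.sum_replicate, mul_comm]

end Literature.GroupTheory.CombinatorialGroupTheory
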